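import Mathlib.Algebra.Order.BigOperators.Ring.Finset
import Summits.Ventures.LatticeQCDFlow.Scaling.SwapLadderDeliveryTime

/-!
HONEST FRAMING: exact (Metropolis-corrected) sampling algorithms for lattice gauge theory; figures
of merit are autocorrelation/cost numbers at stated couplings and volumes; no continuum-physics
claim.

# SwapLadderRoundTrip — THE ROUND TRIP OF THE IDEALISED LABEL WALK WITH AN ARBITRARY ACCEPTANCE PROFILE
# `a_0, …, a_{K−1}` IS EXACTLY `2(K+1)·Σ_j 1/a_j`: THE HARMONIC MEAN OF THE PAIR ACCEPTANCES, NOT THE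
# ARITHMETIC ONE, SETS IT; A PER-PAIR BAND `m ≤ a_j ≤ M` PINS IT TO `[2K(K+1)/M, 2K(K+1)/m]` (row 22
# `su3-ptbc`, GEN-5, ours; part 1 of 2 — the Gaussian-model optimality of the equal-acceptance ladder is
# the sequel `SwapLadderRoundTripOptimum`)

Venture `LatticeQCDFlow` (cell pub-lqcd), topic `Scaling`; FANOUT row 22 (`su3-ptbc`, PTBC comparator arm
E4).  NEW WORK of the cell = an instance of the tree's Literature birth-and-death hitting times
(`Literature.Probability.MarkovChains.BirthDeathHittingTimes`: Levin–Peres–Wilmer §2.5 eq. (2.13)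
`E_{ℓ−1}(τ_ℓ) = (1/(q_ℓ w_ℓ)) Σ_{j<ℓ} w_j` and "to find `E_a(τ_b)` just sum"; existence / uniqueness of
hitting times for irreducible chains from `RandomTargetLemma`) and of GEN-4's `SwapLadderDeliveryTime`
(the uniform profile; `bdKernel_isIrreducible`).  Nothing is cited as a fact.

## The walk (GEN-4's idealisation, now with a position-dependent acceptance)

Positions `0, …, K` (PTBC: `0` = the open replica, `K` = the physical replica); bond `j` joins positions
`j` and `j+1` and is crossed, when attempted, with its stationary swap acceptance `a j ∈ (0, 1]`; one
swap round attempts one uniformly chosen side: `profileWalk K a = bdKernel K (profileUp K a) (profileDown a)`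
with up-rate `a k/2` from `k < K` and down-rate `a (k−1)/2` from `k ≥ 1`.  For the constant profile this
IS GEN-4's `ladderWalk K a` (`profileWalk_const`, by `rfl`).  (The values `a j`, `j ≥ K`, never enter the
`(K+1) × (K+1)` kernel; the hypotheses `0 < a j ≤ 1` are stated for all `j` only for brevity.)

## What is proved (`h` any hitting-time solution — it exists uniquely, `existsUnique_profile_hittingTime`)

§1 closed forms
* `bdWeight_profile` — every reversible weight is `1` (the walk is symmetric; uniform stationary law);
* **`profile_step_time`** `E_i(τ_{i+1}) = 2(i+1)/a_i`; **`profile_delivery_time`**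
  `E_0(τ_K) = Σ_{i<K} 2(i+1)/a_i`; `profileWalk_rev` (the reflection `i ↦ K − i` maps the walk onto the
  walk of the reversed profile), `isHittingTimeSolution_comp_equiv_of_eq`, and **`profile_return_time`**
  `E_K(τ_0) = Σ_{i<K} 2(K−i)/a_i`;
* **`profile_round_trip`** — `E_0(τ_K) + E_K(τ_0) = 2(K+1)·Σ_{i<K} 1/a_i`: THE ROUND TRIP DEPENDS ON THE
  PROFILE ONLY THROUGH THE SUM OF THE INVERSE ACCEPTANCES; for the constant profile it is GEN-4's
  `2K(K+1)/a` (`profile_round_trip_const`, cf. `SwapLadderDeliveryTime.ladder_round_trip`).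
§2 what a MEAN acceptance does and does not tell (Cauchy–Schwarz)
* `sq_le_sum_mul_sum_inv` `K² ≤ (Σ a_i)(Σ 1/a_i)`; **`profile_round_trip_ge_of_mean`** — with
  `ā = (Σ_{i<K} a_i)/K`: `2K(K+1)/ā ≤ round trip`: quoting one mean swap acceptance for a non-flat profile
  UNDER-states the model round trip; `profile_round_trip_le_of_forall_le` /
  `profile_round_trip_ge_of_forall_le` — a band `m ≤ a_i ≤ M` gives `2K(K+1)/M ≤ RT ≤ 2K(K+1)/m`;
  **`profile_round_trip_card_band`** — the card's per-pair criterion `20 ± 5 %` (CARD-su3-ptbc §3: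
  every adjacent swap acceptance within `5` percentage points of the `0.20` target) gives
  `(4/5)·10K(K+1) ≤ RT ≤ (4/3)·10K(K+1)`, `10K(K+1)` being the flat-`20 %` value — in the model this,
  and not the mean alone, is what the per-pair uniformity test buys.

PRINTED COUNTERPART (the formula itself is KNOWN; this file is our kernel-checked derivation from the tree's
Levin–Peres first-step equations, nothing cited as a fact): `profileWalk` IS the index process of the
STOCHASTIC even–odd (SEO, reversible) swap scheme under the 'efficient local exploration' idealisation of
Syed–Bouchard-Côté–Deligiannidis–Doucet, J. R. Stat. Soc. B 84 (2022) 321 (arXiv:1905.02939), §3.3 and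
App. B (each scan the tagged index draws a direction `±1` uniformly and moves with the swap acceptance of that
bond), and `profile_round_trip` is their Theorem 1, SEO case — `E_SEO[T] = 2(N+1)N + 2(N+1)·Σ_i r_i/s_i`,
`r_i = 1 − s_i` — in the form `2(K+1)·Σ_i 1/a_i` (`1/a = 1 + r/s`; the printed form is
`profile_round_trip_inefficiency`); they credit the reversible formula to Nadler–Hansmann, Phys. Rev. E 75
(2007) 026109.  Their DETERMINISTIC even–odd scheme (DEO, Okabe et al. 2001; the scheme of row 22's driver
`ptbc_lf.swap_step`: even pairs then odd pairs every macro-step) has `E_DEO[T] = 2(N+1) + 2(N+1)·Σ_i r_i/s_i`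
— smaller by exactly `2(N+1)(N−1)` and with the SAME dependence on the profile, so the fixed-`K` optimality
of the sequel `SwapLadderRoundTripOptimum` (minimise `Σ_i 1/a_i`) applies to both schemes; the DEO walk is
typed in the sequel `SwapLadderRoundTripDEO`.  Also named: Katzgraber–Trebst–Huse–Troyer, J. Stat. Mech.
(2006) P03018 and Trebst–Troyer's lecture notes (`1/j = ∫ dE/(D(E)H(E))`, the continuum form of `Σ_j 1/a_j`).
Literature grade (cell rule): KNOWN RESULT, NEW TYPING (kernel-checked; the mean/band readings are ours).
NOT CLAIMED: that PTBC's replica-label dynamics IS this walk (successive swap decisions are correlated through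
the configurations — 'ELE' is an idealisation; the card MEASURES round trips); anything about a run or a
number of ours.
-/

noncomputable section

open Finset Real
open Literature.Probability.MarkovChains

namespace Summit.Ventures.LatticeQCDFlow.Scaling

/-! ## §1 The label walk with an acceptance profile and its passage times -/

section Walk

/-- Up-rates of the label walk with acceptance profile `a`: from position `k < K` the bond `k` is attempted
with probability `1/2` and crossed with its acceptance `a k`; nothing above the top. [ours] -/
def profileUp (K : ℕ) (a : ℕ → ℝ) (k : ℕ) : ℝ := if k < K then a k / 2 else 0

/-- Down-rates: from position `k ≥ 1` the bond `k − 1` is crossed with probability `a (k−1)/2`; nothing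
below `0`. [ours] -/
def profileDown (a : ℕ → ℝ) (k : ℕ) : ℝ := if k = 0 then 0 else a (k - 1) / 2

/-- **The idealised label walk of a `K`-interval ladder with acceptance profile `a`** (a symmetric
birth-and-death chain on `Fin (K+1)`). [ours] -/
def profileWalk (K : ℕ) (a : ℕ → ℝ) : Matrix (Fin (K + 1)) (Fin (K + 1)) ℝ :=
  bdKernel K (profileUp K a) (profileDown a)

/-- `profileUp K a k = a k / 2` for `k < K`. [ours] -/
theorem profileUp_of_lt {K : ℕ} (a : ℕ → ℝ) {k : ℕ} (hk : k < K) : profileUp K a k = a k / 2 := if_pos hk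

/-- `profileUp K a K = 0`. [ours] -/
theorem profileUp_top (K : ℕ) (a : ℕ → ℝ) : profileUp K a K = 0 := if_neg (lt_irrefl K)

/-- `profileDown a 0 = 0`. [ours] -/
theorem profileDown_zero (a : ℕ → ℝ) : profileDown a 0 = 0 := if_pos rfl

/-- `profileDown a k = a (k−1) / 2` for `1 ≤ k`. [ours] -/
theorem profileDown_of_pos (a : ℕ → ℝ) {k : ℕ} (hk : 1 ≤ k) : profileDown a k = a (k - 1) / 2 :=
  if_neg (by omega)

/-- **The constant profile is GEN-4's uniform label walk** (`SwapLadderDeliveryTime.ladderWalk`). [ours] -/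
theorem profileWalk_const (K : ℕ) (a : ℝ) : profileWalk K (fun _ => a) = ladderWalk K a := rfl

/-- **The label walk is a transition matrix** for a profile with values in `[0, 1]`. [ours] -/
theorem profileWalk_isRowStochastic (K : ℕ) {a : ℕ → ℝ} (ha0 : ∀ j, 0 ≤ a j) (ha1 : ∀ j, a j ≤ 1) :
    IsRowStochastic (profileWalk K a) := by
  refine bdKernel_isRowStochastic (fun k => ?_) (fun k => ?_) (fun k => ?_) (profileDown_zero a)
    (profileUp_top K a)
  · have := ha0 k
    unfold profileUp; split_ifs <;> linarith
  · have := ha0 (k - 1)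
    unfold profileDown; split_ifs <;> linarith
  · have := ha0 k; have := ha1 k; have := ha0 (k - 1); have := ha1 (k - 1)
    unfold profileUp profileDown; split_ifs <;> linarith

/-- **The label walk is irreducible** for a profile with values in `(0, 1]`. [ours] -/
theorem profileWalk_isIrreducible (K : ℕ) {a : ℕ → ℝ} (ha0 : ∀ j, 0 < a j) (ha1 : ∀ j, a j ≤ 1) :
    IsIrreducible (profileWalk K a) :=
  bdKernel_isIrreducible (profileWalk_isRowStochastic K (fun j => (ha0 j).le) ha1)
    (fun k hk => by rw [profileUp_of_lt a hk]; exact div_pos (ha0 k) two_pos)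
    (fun k hk _ => by rw [profileDown_of_pos a hk]; exact div_pos (ha0 _) two_pos)

/-- **Hitting times of the label walk exist and are unique** (profile in `(0, 1]`). [ours] -/
theorem existsUnique_profile_hittingTime (K : ℕ) {a : ℕ → ℝ} (ha0 : ∀ j, 0 < a j) (ha1 : ∀ j, a j ≤ 1) :
    ∃! h : Fin (K + 1) → Fin (K + 1) → ℝ, IsHittingTimeSolution (profileWalk K a) h := by
  have hP := profileWalk_isRowStochastic K (fun j => (ha0 j).le) ha1
  have hirr := profileWalk_isIrreducible K ha0 ha1
  obtain ⟨h, hh⟩ := exists_isHittingTimeSolution hP hirr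
  exact ⟨h, hh, fun h' hh' => IsHittingTimeSolution.unique hP hirr hh' hh⟩

/-- **The walk is symmetric: every reversible weight `w_k = Π_{i<k} p_i/q_{i+1}` equals `1`** (`k ≤ K`,
positive profile) — its stationary law is uniform over the `K+1` positions. [ours] -/
theorem bdWeight_profile {K : ℕ} {a : ℕ → ℝ} (ha : ∀ j, a j ≠ 0) :
    ∀ k, k ≤ K → bdWeight (profileUp K a) (profileDown a) k = 1
  | 0, _ => bdWeight_zero _ _
  | k + 1, hk => by
    rw [bdWeight_succ, bdWeight_profile ha k (by omega), profileUp_of_lt a (show k < K by omega),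
      profileDown_of_pos a (show 1 ≤ k + 1 by omega), Nat.add_sub_cancel, one_mul]
    exact div_self (div_ne_zero (ha k) two_ne_zero)

variable {K : ℕ} {a : ℕ → ℝ} {h : Fin (K + 1) → Fin (K + 1) → ℝ}

/-- **One rung costs `2(i+1)/a_i` rounds: `E_i(τ_{i+1}) = (i+1)/(a_i/2)`** (Levin–Peres–Wilmer eq. (2.13)
with unit weights). [ours] -/
theorem profile_step_time (hh : IsHittingTimeSolution (profileWalk K a) h) (ha : ∀ j, 0 < a j)
    (i : Fin K) : h i.castSucc i.succ = 2 * ((i.val : ℝ) + 1) / a i.val := by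
  have hp : ∀ k, k < K → profileUp K a k ≠ 0 := fun k hk => by
    rw [profileUp_of_lt a hk]; exact (div_pos (ha k) two_pos).ne'
  have hq : ∀ k, 1 ≤ k → k ≤ K → profileDown a k ≠ 0 := fun k hk _ => by
    rw [profileDown_of_pos a hk]; exact (div_pos (ha _) two_pos).ne'
  have hne : ∀ j, a j ≠ 0 := fun j => (ha j).ne'
  rw [LevinPeres2017_eq_2_13_div hh (profileDown_zero a) hp hq i]
  have hw : ∀ j ∈ range (i.val + 1), bdWeight (profileUp K a) (profileDown a) j = 1 := fun j hj =>
    bdWeight_profile hne j (by have := mem_range.1 hj; omega)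
  rw [sum_congr rfl hw, sum_const, card_range, bdWeight_profile hne (i.val + 1) (by omega),
    profileDown_of_pos a (show 1 ≤ i.val + 1 by omega), Nat.add_sub_cancel, nsmul_eq_mul, mul_one,
    mul_one]
  have hai := hne i.val
  push_cast
  field_simp

/-- **THE DELIVERY TIME `E_0(τ_K) = Σ_{i<K} 2(i+1)/a_i`** (open end → physical end). [ours] -/
theorem profile_delivery_time (hh : IsHittingTimeSolution (profileWalk K a) h) (ha : ∀ j, 0 < a j) :
    h 0 (Fin.last K) = ∑ i ∈ range K, 2 * ((i : ℝ) + 1) / a i := by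
  have hp : ∀ k, k < K → profileUp K a k ≠ 0 := fun k hk => by
    rw [profileUp_of_lt a hk]; exact (div_pos (ha k) two_pos).ne'
  have hq : ∀ k, 1 ≤ k → k ≤ K → profileDown a k ≠ 0 := fun k hk _ => by
    rw [profileDown_of_pos a hk]; exact (div_pos (ha _) two_pos).ne'
  rw [LevinPeres2017_sec_2_5_sum hh (profileDown_zero a) hp hq (Fin.zero_le (Fin.last K))]
  have hterm : ∀ i : Fin K, (if (0 : Fin (K + 1)).val ≤ i.val ∧ i.val < (Fin.last K).val
      then h i.castSucc i.succ else 0) = 2 * ((i.val : ℝ) + 1) / a i.val := by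
    intro i
    rw [if_pos ⟨Nat.zero_le _, by rw [Fin.val_last]; exact i.isLt⟩, profile_step_time hh ha i]
  rw [sum_congr rfl fun i _ => hterm i, Fin.sum_univ_eq_sum_range (fun m : ℕ => 2 * ((m : ℝ) + 1) / a m) K]

/-- The reversed profile `a_{K−1}, …, a_0` (bond `j` of the reflected ladder is bond `K−1−j`). [ours] -/
def revProfile (K : ℕ) (a : ℕ → ℝ) (j : ℕ) : ℝ := a (K - 1 - j)

/-- `revProfile K a j = a (K − 1 − j)`. [ours] -/
theorem revProfile_apply (K : ℕ) (a : ℕ → ℝ) (j : ℕ) : revProfile K a j = a (K - 1 - j) := rfl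

/-- **A kernel isomorphism transports hitting-time solutions**: if `P' (σ a) (σ b) = P a b` for a bijection
`σ`, then `(a, b) ↦ h' (σ a) (σ b)` solves the first-step equations of `P` whenever `h'` solves those of
`P'`. [folklore] -/
theorem isHittingTimeSolution_comp_equiv_of_eq {X : Type*} [Fintype X] [DecidableEq X] {P P' : Matrix X X ℝ}
    {h' : X → X → ℝ} (hh' : IsHittingTimeSolution P' h') (σ : X ≃ X)
    (hσ : ∀ a b, P' (σ a) (σ b) = P a b) : IsHittingTimeSolution P fun a b => h' (σ a) (σ b) := by
  refine ⟨fun x => hh'.1 (σ x), fun a x hax => ?_⟩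
  have hne : σ a ≠ σ x := fun e => hax (σ.injective e)
  show h' (σ a) (σ x) = 1 + ∑ y, P a y * h' (σ y) (σ x)
  rw [hh'.2 (σ a) (σ x) hne, ← Equiv.sum_comp σ (fun y => P' (σ a) y * h' y (σ x))]
  simp only [hσ]

/-- **Reflection `i ↦ K − i` maps the walk of profile `a` onto the walk of the reversed profile.** [ours] -/
theorem profileWalk_rev (K : ℕ) (a : ℕ → ℝ) (i j : Fin (K + 1)) :
    profileWalk K (revProfile K a) (Fin.rev i) (Fin.rev j) = profileWalk K a i j := by
  unfold profileWalk
  have hi := i.isLt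
  have hj := j.isLt
  have hvi : (Fin.rev i).val = K - i.val := by rw [Fin.val_rev]; omega
  have hvj : (Fin.rev j).val = K - j.val := by rw [Fin.val_rev]; omega
  by_cases hup : j.val = i.val + 1
  · rw [bdKernel_apply_succ hup, bdKernel_apply_pred (show (Fin.rev i).val = (Fin.rev j).val + 1 by omega),
      hvi, profileUp_of_lt a (show i.val < K by omega),
      profileDown_of_pos _ (show 1 ≤ K - i.val by omega), revProfile_apply]
    have e : K - 1 - (K - i.val - 1) = i.val := by omega
    rw [e]
  by_cases hdown : i.val = j.val + 1
  · rw [bdKernel_apply_pred hdown, bdKernel_apply_succ (show (Fin.rev j).val = (Fin.rev i).val + 1 by omega),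
      hvi, profileDown_of_pos a (show 1 ≤ i.val by omega),
      profileUp_of_lt _ (show K - i.val < K by omega), revProfile_apply]
    have e : K - 1 - (K - i.val) = i.val - 1 := by omega
    rw [e]
  by_cases heq : i = j
  · subst heq
    rw [bdKernel_apply_self, bdKernel_apply_self, hvi]
    unfold profileUp profileDown revProfile
    by_cases h0 : i.val = 0
    · have e1 : ¬ K - i.val < K := by omega
      rw [if_neg e1, if_pos h0]
      by_cases hK : i.val < K
      · have e2 : ¬ K - i.val = 0 := by omega
        have e3 : K - 1 - (K - i.val - 1) = i.val := by omega
        rw [if_pos hK, if_neg e2, e3]; ring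
      · have e2 : K - i.val = 0 := by omega
        rw [if_neg hK, if_pos e2]
    · have e1 : K - i.val < K := by omega
      have e3 : K - 1 - (K - i.val) = i.val - 1 := by omega
      rw [if_pos e1, if_neg h0, e3]
      by_cases hK : i.val < K
      · have e2 : ¬ K - i.val = 0 := by omega
        have e4 : K - 1 - (K - i.val - 1) = i.val := by omega
        rw [if_pos hK, if_neg e2, e4]; ring
      · have e2 : K - i.val = 0 := by omega
        rw [if_neg hK, if_pos e2]; ring
  · have hrne : Fin.rev i ≠ Fin.rev j := fun e => heq (Fin.rev_inj.1 e)
    rw [bdKernel_apply_of_ne hup hdown heq,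
      bdKernel_apply_of_ne (show (Fin.rev j).val ≠ (Fin.rev i).val + 1 by omega)
        (show (Fin.rev i).val ≠ (Fin.rev j).val + 1 by omega) hrne]

/-- **THE RETURN TIME `E_K(τ_0) = Σ_{i<K} 2(K−i)/a_i`** (physical end → open end; profile in `(0,1]`): the
delivery time of the reversed profile, transported by the reflection and identified by uniqueness. [ours] -/
theorem profile_return_time (ha0 : ∀ j, 0 < a j) (ha1 : ∀ j, a j ≤ 1)
    (hh : IsHittingTimeSolution (profileWalk K a) h) :
    h (Fin.last K) 0 = ∑ i ∈ range K, 2 * ((K : ℝ) - i) / a i := by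
  have hP := profileWalk_isRowStochastic K (fun j => (ha0 j).le) ha1
  have hirr := profileWalk_isIrreducible K ha0 ha1
  have ha0' : ∀ j, 0 < revProfile K a j := fun j => ha0 _
  have ha1' : ∀ j, revProfile K a j ≤ 1 := fun j => ha1 _
  obtain ⟨h', hh', -⟩ := existsUnique_profile_hittingTime K ha0' ha1'
  -- the reflected solution of the reversed walk solves the original walk, hence equals `h`
  have hh'' : IsHittingTimeSolution (profileWalk K a) fun x y => h' (Fin.rev x) (Fin.rev y) :=
    isHittingTimeSolution_comp_equiv_of_eq hh' Fin.revPerm (fun x y => profileWalk_rev K a x y)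
  have heq := IsHittingTimeSolution.unique hP hirr hh'' hh
  have key := congrFun (congrFun heq (Fin.last K)) 0
  simp only [Fin.rev_zero, Fin.rev_last] at key
  rw [← key, profile_delivery_time hh' ha0']
  -- `Σ_{i<K} 2(i+1)/a(K−1−i) = Σ_{j<K} 2(K−j)/a j`
  rw [← Finset.sum_range_reflect (fun j => 2 * ((K : ℝ) - j) / a j) K]
  refine sum_congr rfl fun i hi => ?_
  have hiK := mem_range.1 hi
  have e : ((K - 1 - i : ℕ) : ℝ) = (K : ℝ) - 1 - i := by
    have h1 : (K - 1 - i : ℕ) + 1 + i = K := by omega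
    have h2 := congrArg (fun n : ℕ => (n : ℝ)) h1
    push_cast at h2
    linarith
  rw [revProfile_apply, e]
  ring

/-- **THE ROUND TRIP (commute time) `E_0(τ_K) + E_K(τ_0) = 2(K+1)·Σ_{i<K} 1/a_i`**: it depends on the
acceptance profile only through the SUM OF THE INVERSE pair acceptances (`K` times the inverse harmonic
mean). [ours] -/
theorem profile_round_trip (ha0 : ∀ j, 0 < a j) (ha1 : ∀ j, a j ≤ 1)
    (hh : IsHittingTimeSolution (profileWalk K a) h) :
    h 0 (Fin.last K) + h (Fin.last K) 0 = 2 * ((K : ℝ) + 1) * ∑ i ∈ range K, 1 / a i := by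
  rw [profile_delivery_time hh ha0, profile_return_time ha0 ha1 hh, mul_sum, ← sum_add_distrib]
  refine sum_congr rfl fun i _ => ?_
  have := (ha0 i).ne'
  field_simp
  ring

/-- **The printed form (Syed et al. 2022, Thm 1, SEO; Nadler–Hansmann 2007)**: round trip
`= 2(K+1)·K + 2(K+1)·Σ_i (1 − a_i)/a_i` — the rejection-free random-walk time plus `2(K+1)` times the
'schedule inefficiency' `Σ_i r_i/s_i`. [ours] -/
theorem profile_round_trip_inefficiency (ha0 : ∀ j, 0 < a j) (ha1 : ∀ j, a j ≤ 1)
    (hh : IsHittingTimeSolution (profileWalk K a) h) :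
    h 0 (Fin.last K) + h (Fin.last K) 0
      = 2 * ((K : ℝ) + 1) * K + 2 * ((K : ℝ) + 1) * ∑ i ∈ range K, (1 - a i) / a i := by
  rw [profile_round_trip ha0 ha1 hh]
  have e : ∀ i ∈ range K, 1 / a i = 1 + (1 - a i) / a i := fun i _ => by
    have := (ha0 i).ne'
    field_simp
    ring
  rw [sum_congr rfl e, sum_add_distrib, sum_const, card_range, nsmul_eq_mul, mul_one]
  ring

/-- Consistency with GEN-4 (`SwapLadderDeliveryTime.ladder_round_trip`): for the constant profile the
formula is `2(K+1)·K/a = 2K(K+1)/a`. [ours] -/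
theorem profile_round_trip_const {a : ℝ} (ha0 : 0 < a) (ha1 : a ≤ 1)
    (hh : IsHittingTimeSolution (profileWalk K (fun _ => a)) h) :
    h 0 (Fin.last K) + h (Fin.last K) 0 = 2 * ((K : ℝ) * (K + 1) / a) := by
  rw [profile_round_trip (fun _ => ha0) (fun _ => ha1) hh, sum_const, card_range, nsmul_eq_mul]
  ring

end Walk

/-! ## §2 A mean acceptance under-estimates the round trip; a per-pair band pins it -/

section Mean

variable {K : ℕ} {a : ℕ → ℝ} {h : Fin (K + 1) → Fin (K + 1) → ℝ}

/-- **Cauchy–Schwarz: `K² ≤ (Σ_{i<K} a_i)·(Σ_{i<K} 1/a_i)`** (positive `a`). [folklore] -/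
theorem sq_le_sum_mul_sum_inv (K : ℕ) {a : ℕ → ℝ} (ha : ∀ j, 0 < a j) :
    (K : ℝ) ^ 2 ≤ (∑ i ∈ range K, a i) * ∑ i ∈ range K, 1 / a i := by
  have key := Finset.sum_sq_le_sum_mul_sum_of_sq_le_mul (range K) (r := fun _ => (1 : ℝ)) (f := a)
    (g := fun i => 1 / a i) (fun i _ => (ha i).le) (fun i _ => (one_div_pos.mpr (ha i)).le)
    (fun i _ => by rw [one_pow, mul_one_div_cancel (ha i).ne'])
  simpa [sum_const, card_range] using key

/-- **`2K(K+1)/ā ≤ round trip`**, `ā = (Σ_{i<K} a_i)/K` the arithmetic mean of the pair acceptances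
(`K ≥ 1`, profile in `(0,1]`): quoting one mean swap acceptance for a non-flat profile UNDER-states the
model round trip. [ours] -/
theorem profile_round_trip_ge_of_mean (hK : 0 < K) (ha0 : ∀ j, 0 < a j) (ha1 : ∀ j, a j ≤ 1)
    (hh : IsHittingTimeSolution (profileWalk K a) h) :
    2 * ((K : ℝ) * (K + 1)) / ((∑ i ∈ range K, a i) / K) ≤ h 0 (Fin.last K) + h (Fin.last K) 0 := by
  rw [profile_round_trip ha0 ha1 hh]
  have hS : 0 < ∑ i ∈ range K, a i :=
    sum_pos (fun i _ => ha0 i) (Finset.nonempty_range_iff.mpr hK.ne')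
  have hKr : (0 : ℝ) < K := by exact_mod_cast hK
  have hCS := sq_le_sum_mul_sum_inv K ha0
  rw [div_div_eq_mul_div, div_le_iff₀ hS]
  -- `2K(K+1)·K ≤ 2(K+1)·(Σ 1/a)·(Σ a)` from `K² ≤ (Σ a)(Σ 1/a)`
  nlinarith

/-- **Upper band: `a_i ≥ m > 0` for every pair ⇒ round trip `≤ 2K(K+1)/m`.** [ours] -/
theorem profile_round_trip_le_of_forall_le {m : ℝ} (hm : 0 < m) (hle : ∀ i ∈ range K, m ≤ a i)
    (ha0 : ∀ j, 0 < a j) (ha1 : ∀ j, a j ≤ 1) (hh : IsHittingTimeSolution (profileWalk K a) h) :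
    h 0 (Fin.last K) + h (Fin.last K) 0 ≤ 2 * ((K : ℝ) * (K + 1)) / m := by
  rw [profile_round_trip ha0 ha1 hh]
  have hsum : ∑ i ∈ range K, 1 / a i ≤ ∑ i ∈ range K, 1 / m :=
    sum_le_sum fun i hi => one_div_le_one_div_of_le hm (hle i hi)
  rw [sum_const, card_range, nsmul_eq_mul] at hsum
  have hK1 : (0 : ℝ) ≤ 2 * ((K : ℝ) + 1) := by positivity
  calc 2 * ((K : ℝ) + 1) * ∑ i ∈ range K, 1 / a i ≤ 2 * ((K : ℝ) + 1) * (K * (1 / m)) :=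
        mul_le_mul_of_nonneg_left hsum hK1
    _ = 2 * ((K : ℝ) * (K + 1)) / m := by field_simp

/-- **Lower band: `a_i ≤ M` for every pair ⇒ round trip `≥ 2K(K+1)/M`.** [ours] -/
theorem profile_round_trip_ge_of_forall_le {M : ℝ} (hle : ∀ i ∈ range K, a i ≤ M)
    (ha0 : ∀ j, 0 < a j) (ha1 : ∀ j, a j ≤ 1) (hh : IsHittingTimeSolution (profileWalk K a) h) :
    2 * ((K : ℝ) * (K + 1)) / M ≤ h 0 (Fin.last K) + h (Fin.last K) 0 := by
  rw [profile_round_trip ha0 ha1 hh]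
  rcases Nat.eq_zero_or_pos K with hK | hK
  · subst hK; simp
  have hM : 0 < M := (ha0 0).trans_le (hle 0 (mem_range.mpr hK))
  have hsum : ∑ i ∈ range K, 1 / M ≤ ∑ i ∈ range K, 1 / a i :=
    sum_le_sum fun i hi => one_div_le_one_div_of_le (ha0 i) (hle i hi)
  rw [sum_const, card_range, nsmul_eq_mul] at hsum
  have hK1 : (0 : ℝ) ≤ 2 * ((K : ℝ) + 1) := by positivity
  calc 2 * ((K : ℝ) * (K + 1)) / M = 2 * ((K : ℝ) + 1) * (K * (1 / M)) := by field_simp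
    _ ≤ 2 * ((K : ℝ) + 1) * ∑ i ∈ range K, 1 / a i := mul_le_mul_of_nonneg_left hsum hK1

/-- **THE CARD'S PER-PAIR CRITERION `20 ± 5 %` AS A ROUND-TRIP BAND** (CARD-su3-ptbc §3: every adjacent
swap acceptance within `5` percentage points of the `20 %` target): with every `a_i ∈ [3/20, 1/4]` the model
round trip lies between `4/5` and `4/3` of the flat-profile value `2K(K+1)/(1/5) = 10K(K+1)`. [ours] -/
theorem profile_round_trip_card_band (hband : ∀ i ∈ range K, 3 / 20 ≤ a i ∧ a i ≤ 1 / 4)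
    (ha0 : ∀ j, 0 < a j) (ha1 : ∀ j, a j ≤ 1) (hh : IsHittingTimeSolution (profileWalk K a) h) :
    4 / 5 * (10 * ((K : ℝ) * (K + 1))) ≤ h 0 (Fin.last K) + h (Fin.last K) 0 ∧
      h 0 (Fin.last K) + h (Fin.last K) 0 ≤ 4 / 3 * (10 * ((K : ℝ) * (K + 1))) := by
  constructor
  · have h1 := profile_round_trip_ge_of_forall_le (M := 1 / 4) (fun i hi => (hband i hi).2) ha0 ha1 hh
    have e : 2 * ((K : ℝ) * (K + 1)) / (1 / 4) = 4 / 5 * (10 * ((K : ℝ) * (K + 1))) := by ring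
    rwa [e] at h1
  · have h1 := profile_round_trip_le_of_forall_le (m := 3 / 20) (by norm_num) (fun i hi => (hband i hi).1)
      ha0 ha1 hh
    have e : 2 * ((K : ℝ) * (K + 1)) / (3 / 20) = 4 / 3 * (10 * ((K : ℝ) * (K + 1))) := by ring
    rwa [e] at h1

end Mean

end Summit.Ventures.LatticeQCDFlow.Scaling

end
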